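import Literature.AlgebraicGeometry.Modules.TildeLocallyFree
import HarnessLib

/-!
# Sheaves of modules on the spectrum of a field are free: `M ≅ M(Spec K)~ ≅ 𝒪^{(I)}`

Let `K` be a field. The scheme `Spec K` has one point, so an `𝒪_{Spec K}`-module `M` is determined by
its `K`-vector space of global sections `M(Spec K)`, and choosing a basis exhibits `M` as a free
module: `M ≅ 𝒪_{Spec K}^{(I)}`. In the language of Mathlib's `Modules/Tilde` this is: every sheaf of
modules on `Spec K` is *localizing* (Hartshorne II Prop. 5.1 / Cor. 5.5: the sections over a
principal open `D(c)` are the localization `M(Spec K)_c` — for `c ≠ 0` one has `D(c) = Spec K` and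
`c` is a unit, for `c = 0` one has `D(0) = ∅` where a sheaf has only the zero section), hence the
counit `M(Spec K)~ ⟶ M` is an isomorphism (Mathlib `isIso_fromTildeΓ_iff_isLocalizing`), and
`V~ ≅ 𝒪^{(I)}` for a `K`-basis of `V` indexed by `I` (tree `Modules/TildeLocallyFree.tildeIsoFreeOfBasis`,
Görtz–Wedhorn I Cor. 7.42 / Prop. 7.24).

* `sections_bot_eq_zero` — a sheaf of modules has only the zero section over `∅`;
* `isLocalizing_of_isField` — every `𝒪_{Spec K}`-module is localizing;
* `isIso_fromTildeΓ_of_isField` — hence `M(Spec K)~ ≅ M`;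
* `nonempty_iso_free_of_basis_of_isField` — **`M ≅ 𝒪^{(I)}` for any `K`-basis of `Γ(M, ⊤)`
  indexed by `I`** (Mathlib's `K`-module structure on `Γ(M, ⊤)`, `Scheme.Modules.smul_Spec_def`);
  `nonempty_iso_free_of_basis_sections_of_isField` / `…_of_card_eq` — the same for a basis over the
  ring of global functions `Γ(Spec K, 𝒪) ≅ K` (the native scalars), resp. of prescribed finite rank.

The field is a bundled `R : CommRingCat` with `hR : IsField R`, so that the lemmas apply verbatim to
`R = CommRingCat.of K`, `hR = Field.toIsField K`, and to Mathlib's `Spec (.of R)`-typed API.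

Everything is proved; no definitions, no named facts. Written for cell `pub-hodge-ring2` (route №4,
crux stmt-HodgeConjecture-26512, stub `stub_cotangentSheafFree`: the fibre `e^*Ω¹_{A/K}` of the
cotangent sheaf of an abelian variety at the origin is a free `𝒪_{Spec K}`-module of rank `dim A`,
`Motives/AbelianVarietyCotangentSheafAtOrigin`).

presearch: «sheaf of modules over Spec of a field is free / determined by global sections» →
[Hartshorne1977 II Cor. 5.5 + Prop. 5.2] (quasi-coherent modules on `Spec A` are `M~`; over a field
every module is quasi-coherent, one point) — textbook; tree: rg `Spec (.of K)).Modules` → only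
`Subsingleton (Spec K)` uses, no freeness statement; Mathlib pin: `isIso_fromTildeΓ_iff_isLocalizing`,
`tildeFinsupp`, nothing field-specific; corpus+galaxy not queried (textbook plumbing).

## References

* R. Hartshorne, *Algebraic Geometry*, GTM 52 (1977), II Prop. 5.1, Prop. 5.2, Cor. 5.5. [Hartshorne1977]
* U. Görtz, T. Wedhorn, *Algebraic Geometry I*, 2nd ed. (2020), Prop. 7.24, Cor. 7.42. [GortzWedhorn2020]
-/

noncomputable section

open CategoryTheory AlgebraicGeometry TopologicalSpace Opposite

universe u

namespace Literature.AlgebraicGeometry.Modules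

/-! ### A sheaf of modules has only the zero section over the empty open -/

section Bot

variable {R : CommRingCat.{u}} {X : TopCat.{u}}

/-- Over `∅` a sheaf of modules has only the zero section (the empty component of a sheaf is terminal,
Mathlib `TopCat.Sheaf.isTerminalOfEmpty`; Hartshorne builds `𝓕(∅) = 0` into the definition of a
(pre)sheaf of abelian groups). [cite: Hartshorne1977, II §1 Definition of presheaf, condition 𝓕(∅) = 0 (p. 61)] -/
theorem sections_bot_eq_zero (M : TopCat.Sheaf (ModuleCat.{u} R) X) (y : M.obj.obj (op ⊥)) : y = 0 := by
  have h : (𝟙 (M.obj.obj (op ⊥)) : M.obj.obj (op ⊥) ⟶ M.obj.obj (op ⊥)) = 0 :=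
    (TopCat.Sheaf.isTerminalOfEmpty M).hom_ext _ _
  have := congrArg (fun φ : M.obj.obj (op ⊥) ⟶ M.obj.obj (op ⊥) => φ.hom y) h
  simpa using this

/-- Variant for an open equal to `∅`. [cite: Hartshorne1977, II §1 Definition of presheaf, condition 𝓕(∅) = 0 (p. 61)] -/
theorem sections_eq_zero_of_eq_bot (M : TopCat.Sheaf (ModuleCat.{u} R) X) {U : Opens X} (hU : U = ⊥)
    (y : M.obj.obj (op U)) : y = 0 := by
  subst hU
  exact sections_bot_eq_zero M y

end Bot

/-! ### Every `𝒪_{Spec K}`-module is localizing -/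

section Field

/- We work with a bundled commutative ring `R : CommRingCat` which IS A FIELD (`hR : IsField R`), so that
the statements apply verbatim to `R = CommRingCat.of K` (`hR = Field.toIsField K`) and Mathlib's
`Spec (.of R)`-typed API (`fromTildeΓ`) unifies by structure eta. -/
variable {R : CommRingCat.{u}} (hR : IsField R)

-- `TopCat.Presheaf`/`TopCat.Sheaf` are not reducible: as in Mathlib's `AlgebraicGeometry.Modules`.
set_option backward.isDefEq.respectTransparency false

include hR in
/-- **Every sheaf of modules on the spectrum of a field is localizing**: for every `c ∈ K` the
restriction `M(Spec K) → M(D(c))` is a localization at `c` — for `c ≠ 0` it is a bijection and `c` is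
a unit, for `c = 0` the target `M(∅)` is zero (Hartshorne II Prop. 5.1 (c) in the degenerate case of a
one-point spectrum). [cite: Hartshorne1977, II Prop. 5.1 and Cor. 5.5] -/
theorem isLocalizing_of_isField (N : (Spec R).Modules) :
    IsLocalizing (modulesSpecToSheaf.obj N) := by
  intro c
  by_cases hc : c = 0
  · -- `D(0) = ∅`: the target is the zero module
    have hbot : PrimeSpectrum.basicOpen c = ⊥ := by
      rw [PrimeSpectrum.basicOpen_eq_bot_iff, hc]; exact IsNilpotent.zero
    have hz : ∀ y : (modulesSpecToSheaf.obj N).obj.obj (op (PrimeSpectrum.basicOpen c)),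
        y = 0 := fun y => sections_eq_zero_of_eq_bot _ hbot y
    refine { map_units := ?_, surj := ?_, exists_of_eq := ?_ }
    · intro s
      haveI : Subsingleton ((modulesSpecToSheaf.obj N).obj.obj (op (PrimeSpectrum.basicOpen c))) :=
        ⟨fun a b => (hz a).trans (hz b).symm⟩
      exact isUnit_of_subsingleton _
    · intro y
      exact ⟨(0, 1), by rw [hz y, smul_zero, map_zero]⟩
    · intro x₁ x₂ _
      exact ⟨⟨c, Submonoid.mem_powers c⟩, by simp [Submonoid.smul_def, hc]⟩
  · -- `c` is a unit and `D(c) = Spec K`: the restriction is a bijection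
    obtain ⟨d, hd⟩ := hR.mul_inv_cancel hc
    have htop : PrimeSpectrum.basicOpen c = ⊤ := by
      apply le_antisymm le_top
      have h1 : PrimeSpectrum.basicOpen (c * d) = ⊤ := by
        rw [hd, PrimeSpectrum.basicOpen_one]
      rw [← h1, PrimeSpectrum.basicOpen_mul]
      exact inf_le_left
    -- the restriction `M(Spec K) → M(D(c))` is invertible: `D(c) = Spec K`
    have hid : ∀ (U : Opens (PrimeSpectrum R)) (f : U ⟶ U),
        (modulesSpecToSheaf.obj N).obj.map f.op = 𝟙 _ := fun U f => by
      rw [Subsingleton.elim f (𝟙 U), op_id, CategoryTheory.Functor.map_id]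
    let j : (⊤ : Opens (PrimeSpectrum R)) ⟶ PrimeSpectrum.basicOpen c := eqToHom htop.symm
    haveI : IsIso ((modulesSpecToSheaf.obj N).obj.map (PrimeSpectrum.basicOpen c).leTop.op) := by
      refine ⟨(modulesSpecToSheaf.obj N).obj.map j.op, ?_, ?_⟩
      · rw [← Functor.map_comp, ← op_comp]
        exact hid _ _
      · rw [← Functor.map_comp, ← op_comp]
        exact hid _ _
    have hbij := ConcreteCategory.bijective_of_isIso
      ((modulesSpecToSheaf.obj N).obj.map (PrimeSpectrum.basicOpen c).leTop.op)
    refine { map_units := ?_, surj := ?_, exists_of_eq := ?_ }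
    · rintro ⟨s, n, rfl⟩
      have hu : IsUnit (c ^ n) := (IsUnit.of_mul_eq_one d hd).pow n
      rw [Module.End.isUnit_iff]
      constructor
      · intro a b hab
        simp only [Module.algebraMap_end_apply] at hab
        exact hu.smul_left_cancel.mp hab
      · intro y
        exact ⟨hu.unit⁻¹ • y, by
          rw [Module.algebraMap_end_apply, Units.smul_def, smul_smul, IsUnit.mul_val_inv, one_smul]⟩
    · intro y
      obtain ⟨x, hx⟩ := hbij.2 y
      exact ⟨(x, 1), by simpa using hx.symm⟩
    · intro x₁ x₂ h
      exact ⟨1, by simpa using hbij.1 h⟩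

include hR in
/-- **`M(Spec K)~ ≅ M`**: on the spectrum of a field the counit `fromTildeΓ` of `~ ⊣ Γ` is an
isomorphism for EVERY sheaf of modules (Mathlib `isIso_fromTildeΓ_iff_isLocalizing`).
[cite: Hartshorne1977, II Cor. 5.5] -/
theorem isIso_fromTildeΓ_of_isField (N : (Spec R).Modules) : IsIso N.fromTildeΓ :=
  (isIso_fromTildeΓ_iff_isLocalizing N).mpr (isLocalizing_of_isField hR N)

include hR in
/-- **Every `𝒪_{Spec K}`-module is free: `M ≅ 𝒪^{(I)}` for any `K`-basis, indexed by `I`, of its global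
sections** (Mathlib's `K`-module `Γ(M, ⊤)`, `K` acting through `K ≅ Γ(Spec K, 𝒪)`, `smul_Spec_def`):
`M ≅ M(Spec K)~ ≅ 𝒪^{(I)}` (tree `tildeIsoFreeOfBasis`).
[cite: Hartshorne1977, II Prop. 5.2 and Cor. 5.5] [cite: GortzWedhorn2020, Cor 7.42] -/
theorem nonempty_iso_free_of_basis_of_isField (N : (Spec R).Modules) {I : Type u}
    (b : Module.Basis I R Γ(N, ⊤)) : Nonempty (N ≅ SheafOfModules.free I) :=
  haveI := isIso_fromTildeΓ_of_isField hR N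
  ⟨(asIso N.fromTildeΓ).symm ≪≫ tildeIsoFreeOfBasis (M := Γ(N, ⊤)) b⟩

/-- The `K`-action on `Γ(M, ⊤)` is the `Γ(Spec K, 𝒪)`-action through `Γ(Spec K, 𝒪) ≅ K` (Mathlib
`Scheme.ΓSpecIso`, `smul_Spec_def`): `(ΓSpecIso c) • x = c • x`. [folklore] -/
theorem ΓSpecIso_hom_smul (N : (Spec R).Modules) (c : Γ(Spec R, ⊤)) (x : Γ(N, ⊤)) :
    (Scheme.ΓSpecIso R).hom c • x = c • x := by
  rw [Scheme.Modules.smul_Spec_def]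
  congr 1
  have h : ((⊤ : (Spec R).Opens).leTop : (⊤ : (Spec R).Opens) ⟶ ⊤) = 𝟙 _ := Subsingleton.elim _ _
  rw [h, op_id, CategoryTheory.Functor.map_id, CommRingCat.id_apply]
  exact CategoryTheory.Iso.hom_inv_id_apply (Scheme.ΓSpecIso R) c

include hR in
/-- **`Γ(Spec K, 𝒪)`-form**: `M ≅ 𝒪^{(I)}` for any basis of the global sections `Γ(M, ⊤)` over the ring
of global functions `Γ(Spec K, 𝒪) (≅ K)` — the native scalars of a sheaf of modules (transported to a
`K`-basis along `Scheme.ΓSpecIso`, Mathlib `Module.Basis.mapCoeffs`). [cite: Hartshorne1977, II Prop. 5.2 and Cor. 5.5] -/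
theorem nonempty_iso_free_of_basis_sections_of_isField (N : (Spec R).Modules) {I : Type u}
    (b : Module.Basis I Γ(Spec R, ⊤) Γ(N, ⊤)) : Nonempty (N ≅ SheafOfModules.free I) :=
  nonempty_iso_free_of_basis_of_isField hR N
    (b.mapCoeffs (Scheme.ΓSpecIso R).commRingCatIsoToRingEquiv (fun c x => ΓSpecIso_hom_smul N c x))

include hR in
/-- **Finite rank form**: if `Γ(M, ⊤)` has a basis over `Γ(Spec K, 𝒪)` with as many elements as `I`
(e.g. `I = Fin n` in universe `0`), then `M ≅ 𝒪^I`. [cite: Hartshorne1977, II Prop. 5.2 and Cor. 5.5] -/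
theorem nonempty_iso_free_of_basis_sections_of_card_eq (N : (Spec R).Modules) {I J : Type u}
    [Fintype I] [Fintype J] (b : Module.Basis J Γ(Spec R, ⊤) Γ(N, ⊤))
    (h : Fintype.card J = Fintype.card I) : Nonempty (N ≅ SheafOfModules.free I) :=
  nonempty_iso_free_of_basis_sections_of_isField hR N (b.reindex (Fintype.equivOfCardEq h))

end Field

end Literature.AlgebraicGeometry.Modules

end
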